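import Literature.AlgebraicGeometry.HodgeTheory.HolomorphicBundleChernCharacterTopDegree
import Literature.AlgebraicGeometry.HodgeTheory.LefschetzOneOneChernWeil
import Literature.AlgebraicGeometry.Motives.AnalytificationFubiniStudyExact
import HarnessLib

/-!
# Chern characters of holomorphic bundles: the hyperplane classes are algebraic (Voisin I, Thm. 11.32 ⊗ ℂ, degree 2)

Family `hodge`, layer `Literature/AlgebraicGeometry/HodgeTheory`. Fourth proofs file of
`HolomorphicBundleChernCharacter` (the named fact
`span_holomorphicBundleChernCharacter_eq_algebraicClasses`, Voisin I Thm. 11.32 ⊗ ℂ). The previous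
file (`…TopDegree`) produced, for `X` smooth projective with a projective embedding `ι : X ⟶ ℙᴺ`, a
Hodge model `A` and `p ≤ dim X`, the NON-ZERO class `c_p ∈ H²ᵖ(X(ℂ); ℂ)` of
`ch_p(𝒪(-1)|_{X^an}) = [(1/p!) (-θ/2π)ᵖ]`, `θ` the restricted Fubini–Study form. Here these classes
are shown to be SUPPORTED ON A HYPERPLANE SECTION — the first instance in the tree of the inclusion
"Chern classes are classes of algebraic cycles" of Thm. 11.32 (Voisin I, §11.1.2 and the proof of
Thm. 11.33: "`c₁(Lᵢ)` vanishes on `X − Dᵢ`, since `Lᵢ` is trivial on `X − Dᵢ`"; Prop. 11.35 /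
Cor. 11.34: `c₁(L) = [D]`):

* `HodgeModel.map_val_pullback_eq_zero_of_map_mk_eq_zero` — transport: if the de Rham class of a
  global form `Θ` dies on an open submanifold `U ⊆ X^an` then the comparison class dies on `U` in
  singular cohomology (naturality of `A.deRham` for the inclusion `U → X^an`; `U` is σ-compact,
  `HodgeModel.sigmaCompactSpace_opens` of `LefschetzOneOneChernWeil`, whose assembly this step mirrors);
* `HodgeModel.restrictCompl_eq_zero_of_map_val_eq_zero` — and then dies on `(X ∖ Z)(ℂ)` whenever
  `U = φ⁻¹((X ∖ Z)(ℂ))` (the tree's `restrictCompl_eq_zero_of_pullback`, `LefschetzOneOneProofs`);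
* `HodgeModel.exists_mem_chernCharacterSet_tautologicalBundle_mem_supportedClasses` — **for
  `1 ≤ p ≤ dim X`, `ch_p(𝒪(-1)|_{X^an})` is a non-zero class of `N¹ H²ᵖ(X(ℂ); ℂ)`**, supported on
  the hyperplane section `X ∩ {xⱼ = 0}` of any chart meeting `X`: on `Mⱼ = φ⁻¹(ι⁻¹D₊(xⱼ)(ℂ))` the
  form `θᵖ` is EXACT (`AnalytificationFubiniStudyExact`: `θ = d(Gⱼ^*α₀)` there), `X ∩ {xⱼ = 0}` is a
  proper Zariski-closed subset of the integral `X`, hence of codimension `≥ 1`;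
* `exists_mem_holomorphicBundleChernCharacter_ne_zero_mem_algebraicClasses_one` — **degree `2`:
  a non-zero class lies in BOTH `span {ch₁(E)}` and `algebraicClasses X 1 = N¹ H²`** (`dim X ≥ 1`),
  i.e. the two sides of Thm. 11.32 ⊗ ℂ meet non-trivially in degree `2`;
* `span_holomorphicBundleChernCharacter_eq_algebraicClasses_one_of_finrank_eq_one` — hence **the
  fact HOLDS in degree `2` whenever `b₂(X) = 1`** (both sides are the line `H²(X(ℂ); ℂ)`), e.g. for
  smooth hypersurfaces and complete intersections of dimension `≥ 3` by the Lefschetz hyperplane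
  theorem (Voisin II, §1.2.3);
* `span_holomorphicBundleChernCharacter_eq_top_of_finrank_eq_one` /
  `…_eq_algebraicClasses_of_finrank_eq_one_of_eq_top` — in any degree `2p`, `p ≤ dim X`, with
  `b_{2p}(X) = 1` the Chern characters span `H²ᵖ`, so the fact there is equivalent to
  `algebraicClasses X p = ⊤`.

All statements are theorems; no definitions, no named facts.

## References

* C. Voisin, *Hodge Theory and Complex Algebraic Geometry I* (CUP 2002), §11.1.2, Thm. 11.32,
  Thm. 11.33 (proof), Cor. 11.34, Prop. 11.35. [VoisinHodgeI2002]
* A. Grothendieck, *Hodge's general conjecture is false for trivial reasons*, Topology 8 (1969), §1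
  (the coniveau filtration `Nᵖ`). [GrothendieckTopology1969]
* J.-P. Serre, *GAGA*, Ann. Inst. Fourier 6 (1956), §5. [SerreGAGA1956]
-/

noncomputable section

open scoped Manifold ContDiff
open CategoryTheory AlgebraicGeometry
open Literature.Geometry.Kaehler
open Literature.NumberTheory.Transcendental
open Literature.AlgebraicGeometry.Motives (kaehlerFormPow)
open Literature.AlgebraicGeometry.Motives.AnalytificationKaehler

namespace Literature.AlgebraicGeometry.HodgeTheory

section HodgeTheory

open Literature.AlgebraicTopology.SingularHomology

variable {n : ℕ} {X : Motives.SchemeOver ℂ}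

/-! ### Open submanifolds of a Hodge model: topology and transport of vanishing -/

/-- **Transport of de Rham vanishing on an open submanifold to singular cohomology.** For a Hodge
model `A`, an open submanifold `U ⊆ M = A.carrier`, a closed smooth complex form `Θ` on `M` whose
restriction to `U` is EXACT (its class maps to `0` in `H^k_dR(U; ℂ)`), and a class `c ∈ Hᵏ(X(ℂ); ℂ)`
with `A.pullback c = A.deRham [Θ]`: the pull-back of `c` to `U` vanishes in `Hᵏ(U; ℂ)` — naturality
of the comparison `A.deRham` for the `C^∞` inclusion `U → M` (`HodgeModel.deRham_isNatural`).
[cite: SerreGAGA1956, §5] -/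
theorem HodgeModel.map_val_pullback_eq_zero_of_map_mk_eq_zero (A : HodgeModel n X)
    (U : TopologicalSpace.Opens A.carrier) {k : ℕ} (x : cclosedSmoothForms A.model A.carrier k)
    (hx : complexDeRhamCohomology.map A.model
      (fun z ↦ contMDiff_subtype_val z : ContMDiff 𝓘(ℝ, A.model) 𝓘(ℝ, A.model) ∞ (Subtype.val : U → A.carrier))
        k (complexDeRhamCohomology.mk A.model A.carrier k x) = 0)
    {c : complexBetti X k}
    (hc : A.pullback k c = A.deRham A.carrier k (complexDeRhamCohomology.mk A.model A.carrier k x)) :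
    singularCohomology.map ℂ ℂ
      (⟨Subtype.val, continuous_subtype_val⟩ : C(U, A.carrier)) k (A.pullback k c) = 0 := by
  haveI := A.sigmaCompactSpace_opens U
  have hnat := A.deRham_isNatural U A.carrier (Subtype.val : U → A.carrier)
    (fun z ↦ contMDiff_subtype_val z) k (complexDeRhamCohomology.mk A.model A.carrier k x)
  rw [hx, map_zero] at hnat
  rw [hc]
  exact hnat.symm

/-- **… and to the complement of a Zariski-closed subset.** If moreover `U = φ⁻¹((X ∖ Z)(ℂ))` for
the analytification `φ : M → X(ℂ)` and a subset `Z ⊆ X`, then `c` dies on `(X ∖ Z)(ℂ)`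
(`complexBetti.restrictCompl X Z k c = 0`; the tree's `restrictCompl_eq_zero_of_pullback` along the
homeomorphism `U ≃ (X ∖ Z)(ℂ)`). [cite: SerreGAGA1956, §5] -/
theorem HodgeModel.restrictCompl_eq_zero_of_map_val_eq_zero (A : HodgeModel n X) {Z : Set X.left}
    (U : TopologicalSpace.Opens A.carrier) (hUZ : ∀ m, m ∈ U ↔ (A.toComplexPoints m).pt ∉ Z)
    {k : ℕ} (c : complexBetti X k)
    (h : singularCohomology.map ℂ ℂ
      (⟨Subtype.val, continuous_subtype_val⟩ : C(U, A.carrier)) k (A.pullback k c) = 0) :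
    complexBetti.restrictCompl X Z k c = 0 := by
  set S : Set A.carrier := A.toComplexPoints ⁻¹' {P | P.pt ∈ Z} with hS
  have hiff : ∀ m : A.carrier, m ∉ S ↔ m ∈ U := fun m ↦ by
    rw [hUZ m, hS]
    rfl
  let e : {m : A.carrier // m ∉ S} ≃ₜ U := (Homeomorph.refl A.carrier).subtype hiff
  let ec : C({m : A.carrier // m ∉ S}, U) := e
  have hsq : (⟨Subtype.val, continuous_subtype_val⟩ : C(U, A.carrier)).comp ec =
      (⟨Subtype.val, continuous_subtype_val⟩ : C({m : A.carrier // m ∉ S}, A.carrier)) := by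
    ext m
    rfl
  refine restrictCompl_eq_zero_of_pullback A hS c ?_
  rw [← hsq, singularCohomology.map_comp, ModuleCat.comp_apply, h, map_zero]

/-! ### The hyperplane classes `ch_p(𝒪(-1)|_{X^an})` are supported on a hyperplane section -/

section Tautological

variable {N : ℕ} (ι : X ⟶ Motives.projectiveSpace N ℂ) [IsClosedImmersion ι.left] (A : HodgeModel n X)

/-- **`ch_p(𝒪(-1)|_{X^an})` is a non-zero class supported in codimension `1`, for `1 ≤ p ≤ dim X`.**
For `X` smooth projective with a closed immersion `ι : X ⟶ ℙᴺ`, a Hodge model `A` and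
`1 ≤ p ≤ n`, the Chern character set of the tautological cocycle contains a class `c ≠ 0` with
`c ∈ N¹ H²ᵖ(X(ℂ); ℂ)`: `c` is the class with `A.pullback c = A.deRham [(1/p!) (-θ/2π)ᵖ]` of the
previous file; choosing a chart `ι⁻¹D₊(xⱼ)` meeting `X`, the form `θᵖ` is exact on
`Mⱼ = φ⁻¹(ι⁻¹D₊(xⱼ)(ℂ))` (`smul_kaehlerFormPow_ofReal_pullback_val_mem_cexactSmoothForms`), so `c`
dies on `(X ∖ Hⱼ)(ℂ)`, `Hⱼ = X ∩ {xⱼ = 0}` a proper closed subset of the integral `X`, of codimension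
`≥ 1` at each of its points. This is "`c₁(L)` vanishes on `X − D` since `L` is trivial there"
(Voisin I, proof of Thm. 11.33) for `L = 𝒪(-1)`, `D = Hⱼ`, and its powers.
[cite: VoisinHodgeI2002, Thm. 11.33 (proof) and §11.1.2] -/
theorem HodgeModel.exists_mem_chernCharacterSet_tautologicalBundle_mem_supportedClasses
    (hX : Motives.IsSmoothProjective n X) {p : ℕ} (hp1 : 1 ≤ p) (hp : p ≤ n) :
    ∃ c ∈ A.chernCharacterSet (tautologicalBundle ι A.isAnalytification) p,
      c ≠ 0 ∧ c ∈ supportedClasses X (2 * p) 1 := by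
  -- the class `c` of the previous file
  obtain ⟨g, hgK, hg⟩ := A.exists_isKaehler_kaehlerForm_eq_fubiniStudyPullbackForm hX ι
  set cst : ℂ := (p.factorial : ℂ)⁻¹ * (-(2 * (Real.pi : ℂ))⁻¹) ^ p with hcst
  have hs := A.isSmoothForm_smul_kaehlerFormPow_ofReal g cst p
  have hcl := A.isClosedForm_smul_kaehlerFormPow_ofReal g hgK cst p
  have hne := A.mk_smul_kaehlerFormPow_ofReal_ne_zero g hX hgK (tautological_chernCharacter_const_ne_zero p) hp
  obtain ⟨c, hc⟩ := A.pullback_surjective (2 * p)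
    (A.deRham A.carrier (2 * p) (complexDeRhamCohomology.mk A.model A.carrier (2 * p)
      ⟨_, mem_cclosedSmoothForms hs hcl⟩))
  have hmem : c ∈ A.chernCharacterSet (tautologicalBundle ι A.isAnalytification) p :=
    ⟨tautologicalConnection ι A.isAnalytification, _, hs, hcl,
      A.isChernCharacterForm_tautologicalConnection ι g hg p, hc⟩
  have hc0 : c ≠ 0 := fun h0 ↦ hne (by
    rw [h0, map_zero] at hc
    exact (LinearEquiv.map_eq_zero_iff _).1 hc.symm)
  -- a chart `ι⁻¹D₊(xⱼ)` meeting `X`, and the hyperplane section `Z = X ∖ ι⁻¹D₊(xⱼ)`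
  obtain ⟨m₀⟩ := A.nonempty_carrier hX
  obtain ⟨j, hj⟩ := exists_mem_chartDom (ι := ι) (φ := A.toComplexPoints) m₀
  set Z : Set X.left := ((Motives.GeneratingSections.affineChartData ι).U j : Set X.left)ᶜ with hZ
  have hZc : IsClosed Z := ((Motives.GeneratingSections.affineChartData ι).U j).isOpen.isClosed_compl
  have hZne : Z ≠ Set.univ := fun h ↦ by
    have : (A.toComplexPoints m₀).pt ∈ Z := h ▸ Set.mem_univ _
    exact this hj
  haveI : IsIntegral X.left := Motives.IsSmoothProjective.isIntegral_holds hX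
  have hcodim : ∀ z ∈ Z, ((1 : ℕ) : ℕ∞) ≤ Order.coheight z := fun z hz ↦
    one_le_coheight_of_mem_of_isClosed_of_ne_univ hZc hZne hz
  -- `θᵖ` is exact on `Mⱼ`, so `c` dies on `Mⱼ = φ⁻¹((X ∖ Z)(ℂ))`
  have hUZ : ∀ m, m ∈ chartOpens ι A.isAnalytification j ↔ (A.toComplexPoints m).pt ∉ Z := fun m ↦ by
    rw [mem_chartOpens_iff, hZ, Set.mem_compl_iff, not_not]
    rfl
  have hexact := smul_kaehlerFormPow_ofReal_pullback_val_mem_cexactSmoothForms ι A.isAnalytification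
    g hgK hg j cst hp1
  have hmap : complexDeRhamCohomology.map A.model
      (fun z ↦ contMDiff_subtype_val z : ContMDiff 𝓘(ℝ, A.model) 𝓘(ℝ, A.model) ∞
        (Subtype.val : chartOpens ι A.isAnalytification j → A.carrier))
      (2 * p) (complexDeRhamCohomology.mk A.model A.carrier (2 * p) ⟨_, mem_cclosedSmoothForms hs hcl⟩) = 0 := by
    rw [complexDeRhamCohomology.map_mk]
    exact (Submodule.Quotient.mk_eq_zero _).2 hexact
  have hres : complexBetti.restrictCompl X Z (2 * p) c = 0 :=
    A.restrictCompl_eq_zero_of_map_val_eq_zero (chartOpens ι A.isAnalytification j) hUZ c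
      (A.map_val_pullback_eq_zero_of_map_mk_eq_zero _ _ hmap hc)
  exact ⟨c, hmem, hc0, mem_supportedClasses_of_restrictCompl_eq_zero hZc hcodim hres⟩

end Tautological

/-- **In every degree `2p`, `1 ≤ p ≤ dim X`, some non-zero Chern character of a holomorphic bundle
on `X^an` is supported in codimension `1`** (the class `ch_p(𝒪(-1)|_{X^an})` of a projective
embedding, supported on a hyperplane section). [cite: VoisinHodgeI2002, Thm. 11.33 (proof) and §11.1.2] -/
theorem HodgeModel.exists_mem_holomorphicBundleChernCharacter_ne_zero_mem_supportedClasses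
    (hX : Motives.IsSmoothProjective n X) (A : HodgeModel n X) {p : ℕ} (hp1 : 1 ≤ p) (hp : p ≤ n) :
    ∃ c ∈ A.holomorphicBundleChernCharacter p, c ≠ 0 ∧ c ∈ supportedClasses X (2 * p) 1 := by
  obtain ⟨N, ι, hι⟩ := hX.isProjectiveOver
  obtain ⟨c, hc, hc0, hsupp⟩ :=
    A.exists_mem_chernCharacterSet_tautologicalBundle_mem_supportedClasses ι hX hp1 hp
  exact ⟨c, A.chernCharacterSet_subset_holomorphicBundleChernCharacter
    (tautologicalBundle_isHolomorphic ι A.isAnalytification) p hc, hc0, hsupp⟩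

/-- **Degree `2`: the hyperplane class is an algebraic class AND a Chern character.** For `X`
smooth projective of dimension `n ≥ 1` with a Hodge model `A`, there is a NON-ZERO class of
`H²(X(ℂ); ℂ)` lying both in the generator set `holomorphicBundleChernCharacter A 1` of Thm. 11.32 ⊗ ℂ
(it is `ch₁(𝒪(-1)|_{X^an}) = -[θ/2π]`) and in `algebraicClasses X 1 = N¹ H²(X(ℂ); ℂ)` (it is
supported on a hyperplane section): the two sides of
`span_holomorphicBundleChernCharacter_eq_algebraicClasses` meet non-trivially in degree `2`
(Voisin I, Cor. 11.34 / Prop. 11.35 for `L = 𝒪(1)`: `c₁(𝒪_X(1)) = [X ∩ H]`).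
[cite: VoisinHodgeI2002, Cor. 11.34 and Thm. 11.33 (proof)] -/
theorem exists_mem_holomorphicBundleChernCharacter_ne_zero_mem_algebraicClasses_one
    (hX : Motives.IsSmoothProjective n X) (A : HodgeModel n X) (hn : 1 ≤ n) :
    ∃ c ∈ A.holomorphicBundleChernCharacter 1, c ≠ 0 ∧ c ∈ algebraicClasses X 1 :=
  A.exists_mem_holomorphicBundleChernCharacter_ne_zero_mem_supportedClasses hX le_rfl hn

/-- **Voisin I, Thm. 11.32 ⊗ ℂ in degree `2` when `b₂ = 1` (proved).** For `X` smooth projective of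
dimension `n ≥ 1` with `dim H²(X(ℂ); ℂ) = 1` — e.g. smooth hypersurfaces and complete intersections
of dimension `≥ 3` (Lefschetz hyperplane theorem) — and any Hodge model `A`, the `ℂ`-span of the
first Chern characters of holomorphic bundles equals `algebraicClasses X 1`: both contain the
non-zero hyperplane class, hence both are the whole line `H²(X(ℂ); ℂ)`.
[cite: VoisinHodgeI2002, Thm. 11.32 and Cor. 11.34] -/
theorem span_holomorphicBundleChernCharacter_eq_algebraicClasses_one_of_finrank_eq_one
    (hX : Motives.IsSmoothProjective n X) (A : HodgeModel n X) (hn : 1 ≤ n)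
    (h1 : Module.finrank ℂ (complexBetti X (2 * 1)) = 1) :
    Submodule.span ℂ (A.holomorphicBundleChernCharacter 1) = algebraicClasses X 1 := by
  obtain ⟨c, hc, hc0, halg⟩ :=
    exists_mem_holomorphicBundleChernCharacter_ne_zero_mem_algebraicClasses_one hX A hn
  haveI : FiniteDimensional ℂ (complexBetti X (2 * 1)) := Module.finite_of_finrank_eq_succ h1
  have hline : (ℂ ∙ c) = ⊤ :=
    Submodule.eq_top_of_finrank_eq (by rw [finrank_span_singleton hc0, h1])
  have h₁ : Submodule.span ℂ (A.holomorphicBundleChernCharacter 1) = ⊤ :=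
    eq_top_iff.2 (hline ▸ Submodule.span_mono (Set.singleton_subset_iff.2 hc))
  have h₂ : algebraicClasses X 1 = ⊤ :=
    eq_top_iff.2 (hline ▸ (Submodule.span_singleton_le_iff_mem c _).2 halg)
  rw [h₁, h₂]

/-- **Lines are spanned by the hyperplane class.** For `X` smooth projective, `p ≤ dim X` and
`dim H²ᵖ(X(ℂ); ℂ) = 1`, the `p`-th Chern characters of holomorphic bundles span ALL of
`H²ᵖ(X(ℂ); ℂ)` (the line is spanned by `ch_p(𝒪(-1)|_{X^an}) ≠ 0`); consequently, in such a degree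
the named fact `span_holomorphicBundleChernCharacter_eq_algebraicClasses` is EQUIVALENT to
"every class of `H²ᵖ(X(ℂ); ℂ)` is algebraic" (`algebraicClasses X p = ⊤`, e.g. the Lefschetz range
of `HypersurfaceLefschetz`). [cite: VoisinHodgeI2002, Thm. 11.32 and Thm. 7.14] -/
theorem span_holomorphicBundleChernCharacter_eq_top_of_finrank_eq_one
    (hX : Motives.IsSmoothProjective n X) (A : HodgeModel n X) {p : ℕ} (hp : p ≤ n)
    (h1 : Module.finrank ℂ (complexBetti X (2 * p)) = 1) :
    Submodule.span ℂ (A.holomorphicBundleChernCharacter p) = ⊤ := by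
  obtain ⟨c, hc, hc0⟩ := A.exists_mem_holomorphicBundleChernCharacter_ne_zero hX hp
  haveI : FiniteDimensional ℂ (complexBetti X (2 * p)) := Module.finite_of_finrank_eq_succ h1
  have hline : (ℂ ∙ c) = ⊤ :=
    Submodule.eq_top_of_finrank_eq (by rw [finrank_span_singleton hc0, h1])
  exact eq_top_iff.2 (hline ▸ Submodule.span_mono (Set.singleton_subset_iff.2 hc))

/-- Hence, in a degree `2p` with `p ≤ dim X` and `dim H²ᵖ(X(ℂ); ℂ) = 1`, Thm. 11.32 ⊗ ℂ holds iff
`algebraicClasses X p = ⊤`; in particular it HOLDS there as soon as every class is algebraic (as the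
tree proves above the middle dimension of a hard-Lefschetz `n`-fold, or reduces to the Lefschetz
hyperplane theorem for hypersurfaces, `HypersurfaceLefschetz*`). [cite: VoisinHodgeI2002, Thm. 11.32] -/
theorem span_holomorphicBundleChernCharacter_eq_algebraicClasses_of_finrank_eq_one_of_eq_top
    (hX : Motives.IsSmoothProjective n X) (A : HodgeModel n X) {p : ℕ} (hp : p ≤ n)
    (h1 : Module.finrank ℂ (complexBetti X (2 * p)) = 1) (htop : algebraicClasses X p = ⊤) :
    Submodule.span ℂ (A.holomorphicBundleChernCharacter p) = algebraicClasses X p := by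
  rw [span_holomorphicBundleChernCharacter_eq_top_of_finrank_eq_one hX A hp h1, htop]

/-- The same in the intersection form, for all `1 ≤ p ≤ dim X`: the `ℂ`-span of the `p`-th Chern
characters of holomorphic bundles and the coniveau-`1` piece `N¹ H²ᵖ(X(ℂ); ℂ)` (which contains
`algebraicClasses X p = Nᵖ`) have non-zero intersection. [cite: VoisinHodgeI2002, §11.1.2] -/
theorem span_holomorphicBundleChernCharacter_inf_supportedClasses_ne_bot
    (hX : Motives.IsSmoothProjective n X) (A : HodgeModel n X) {p : ℕ} (hp1 : 1 ≤ p) (hp : p ≤ n) :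
    Submodule.span ℂ (A.holomorphicBundleChernCharacter p) ⊓ supportedClasses X (2 * p) 1 ≠ ⊥ := by
  obtain ⟨c, hc, hc0, hsupp⟩ :=
    A.exists_mem_holomorphicBundleChernCharacter_ne_zero_mem_supportedClasses hX hp1 hp
  rw [Submodule.ne_bot_iff]
  exact ⟨c, ⟨Submodule.subset_span hc, hsupp⟩, hc0⟩

end HodgeTheory

end Literature.AlgebraicGeometry.HodgeTheory

end
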